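import Summits.NavierStokesRegularity.NavierStokesRegularity.Theorems.TypeIQuarterGateScarEnvelopeTypeIForcedTsaiWitnessW5T0Sound
import Summits.NavierStokesRegularity.NavierStokesRegularity.Theorems.TypeIQuarterGateScarEnvelopeTypeIForcedTsaiWitnessW5T1

/-!
# Arm-B lane X: witness table `W5T1` (level 128 rows) as `ForcedTsaiModulusLE` theorems

Cell ns-wall-extremal, PREREG-WALL-1 A1 §B2(a)/(d), lane X (producer ns-wall-eng-5; format/checker/soundness by the
cert hand ns-crc-p2). `witnessTableW5T1` = two rows at level `M = 127.999998`, `s = 17/20`, `deg p ≤ 8`: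
axisymmetric-with-swirl (certified ratio 43.11) and axisymmetric no-swirl (91.69). Composition with
`WitnessRow.sound` via `WitnessTable.sound`; rounded corollaries `ForcedTsaiModulusLE 127 5519` and
`ForcedTsaiModulusLE 127 11737`.

HONEST FRAME: UPPER bounds on the forced-Tsai modulus of the steady backward-Leray operator in an explicit witness
class («a near-profile this good exists»); never an exclusion; Navier–Stokes regularity is OPEN and not addressed here.
`--supports stmt-NavierStokesRegularity-23843 --as helper --computational`.
-/

set_option linter.dupNamespace false

namespace Summit.NavierStokesRegularity.NavierStokesRegularity.Cruxes.ScarEnvelopeTypeI.ForcedTsai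

/-- Table `W5T1` (level 128; axisymmetric with swirl / no swirl, `d = 8`, `s = 17/20`): every row is a
certified forced-Tsai witness. -/
theorem witnessTableW5T1_sound :
    ∀ r ∈ witnessTableW5T1, ForcedTsaiModulusLE (r.M : ℝ) (r.δ : ℝ) :=
  WitnessTable.sound witnessTableW5T1_check

/-- Rounded corollary (row 0, WITH swirl: `M = 63999999/500000 = 127.999998`, `δ = 5518623343/10⁶ = 5518.62…`):
a smooth divergence-free field with `‖curl U‖_{L²(B₁₀)} ≥ 127` and weighted vorticity residual `≤ 5519`
exists (certified ratio `≤ 43.12` at level 128). -/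
theorem forcedTsaiModulusLE_127_5519 : ForcedTsaiModulusLE 127 5519 := by
  have hmem : witnessTableW5T1[0] ∈ witnessTableW5T1 := List.getElem_mem (by decide)
  have h := witnessTableW5T1_sound _ hmem
  refine h.mono ?_ ?_
  · have : (witnessTableW5T1[0]).M = 63999999 / 500000 := by rfl
    rw [this]; push_cast; norm_num
  · have : (witnessTableW5T1[0]).δ = 5518623343 / 1000000 := by rfl
    rw [this]; push_cast; norm_num

/-- Rounded corollary (row 1, NO swirl: `M = 127.999998`, `δ = 1173610163/10⁵ = 11736.10…`): a smooth
divergence-free axisymmetric no-swirl field with `‖curl U‖_{L²(B₁₀)} ≥ 127` and weighted vorticity residual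
`≤ 11737` exists (certified ratio `≤ 91.7`; the no-swirl sector's ratio rises with the level). -/
theorem forcedTsaiModulusLE_127_11737_noswirl : ForcedTsaiModulusLE 127 11737 := by
  have hmem : witnessTableW5T1[1] ∈ witnessTableW5T1 := List.getElem_mem (by decide)
  have h := witnessTableW5T1_sound _ hmem
  refine h.mono ?_ ?_
  · have : (witnessTableW5T1[1]).M = 63999999 / 500000 := by rfl
    rw [this]; push_cast; norm_num
  · have : (witnessTableW5T1[1]).δ = 1173610163 / 100000 := by rfl
    rw [this]; push_cast; norm_num

end Summit.NavierStokesRegularity.NavierStokesRegularity.Cruxes.ScarEnvelopeTypeI.ForcedTsai
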